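import Summits.QuantumFields.YangMills.Theorems.BalabanUVNodesN15TwoGridDressedJetNoFitFullG
import Summits.QuantumFields.YangMills.Theorems.BalabanUVNodesN15TwoGridEntry3Full
import Summits.QuantumFields.YangMills.Theorems.BalabanUVNodesN15TwoGridAveragingDefectRough
import Summits.QuantumFields.YangMills.Theorems.BalabanUVNodesN15TwoGridFirstOrderLetters
import HarnessLib

/-!
# N15 (NE2) — PROGRAMME Λ «THE DRESSED COVARIANT-LAPLACIAN ENTRY OF THE PAIR OF RECORD», part Λ-A: THE OPERATOR IDENTITY `(Δ − V₁)X = 1 + (V − a•Q*Q)X` FOR THE FIRST-ORDER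
# DRESSED VALUE `X = (Δ_a − V₁)⁻¹` OF BAŁABAN's `Δ_a⁻¹`, ITS η-DEFECT `W′∘𝔇(X′, X̄) + 𝔇(W′, W̄)∘X̄`, AND THE BLOCK MAJORANT FROM FIVE LETTERS ON ONE TORUS

WHO ∕ WHEN.  Cell `pub-ymgap`, seat `pub-ymgap-dag-n15-a` (KNIT-BY-NAME seat of Track-A DAG node N15 = NE2, g27); `--kind proof --supports stmt-QuantumFields-27366 --as helper` (K3⁸;
count-neutral).  THEOREMS ONLY (0 `def`).  Trigger (t3′) of HANDOFF §g26.5 («the dressed LAPLACIAN ∕ covariant-Laplacian entry of the pair of record»).  Over n15-b's pair space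
(`bgPair`, `projO_none_bgPair`, `stack`, `unstack`), part 39 (`deltaOp_comp_gOp`), part 46 (`deltaOp_eq` = [B5] (1.73)), part 47 (`hasMaj_landauRe`-shaped letter), part 53 (the Landau
two-grid defect letter), N-IIs (`hasMaj_idef_qvAdjRe_qvRe_rough`-shaped letter), part 57 (`hasMaj_qvRe_comp`, `hasMaj_qvAdjRe_comp`), K-J (entry 0 of the dressed jet), II-B
(`hasMaj_bgPair_comp`-shaped letter), `T4EtaRateDefect.idef_comp∕idef_add∕idef_sub`, `B11SectG.hasMaj_comp_exp` BY NAME; nothing in the tree is modified.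

WHY.  [B9] (3.42)₃ prints the COVARIANT Laplacian `Δ_U G(U)`.  In the abelianised first-order model of (3.52) the dressed value of the pair of record is `X = pr₀ bgPair G (∇G) c a`,
the solution of (3.65) `X = G + G V₁X` with `V₁ = M_c + Σ_μ M_{a_μ}∇_μ` (`unstack c a` on the jet), `G = Δ_a⁻¹`; hence `Δ_aX = 1 + V₁X`, i.e. `X = (Δ_a − V₁)⁻¹`.  By (1.73)
`Δ = Δ_a + V − a•Q*Q` (`Δ = ρ(sLap)` the componentwise lattice Laplacian, `V = ∂Π∂* = landauRe`, `Q = qvRe`), so the model's covariant Laplacian of the dressed value is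
`(Δ − V₁)X = 1 + WX`, `W := V − a•Q*Q` — NO `V₁` on the right (on the King rung, K-D, the analogous right side kept the constraint term `T(1 + VX)` because King's Laplacian letter is
`ΔA₀⁻¹`; here `V` and `a•Q*Q` are explicit operators with their OWN two-grid letters: part 53 `hasMaj_landauDefect_family` and N-IIs `hasMaj_idef_qvAdjRe_qvRe_rough`, both on ROUGH inputs).
Hence `𝔇_P((Δ′ − V₁′)X′, (Δ̄ − V̄₁)X̄) = W′∘𝔇(X′, X̄) + 𝔇(W′, W̄)∘X̄` — entry 0 of the dressed jet (K-J), the `U ≡ 1` majorant of `V′` (part 47), the two operator letters, `Q′*`, `Q′`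
(part 57) and the coarse dressed value's majorant (II-B `hasMaj_bgPair_comp`): every term (3.35)-rated.  The FLAT entry `Δ′X′` is NOT rated under `coeffBgFO` (naked `(c′ − c̄∘π)·X̄λ`) and
is not typed — as on the King rung.

WHAT.  §29 (generic carriers) `covLap_dressed_eq`: `Lap∘X − V₁X̂ = 1 + W∘X` from `Lap∘G = 1 + W∘G` and the (3.65) fixed point; `idef_covLap_dressed_eq`: the η-defect identity above.
§30 (the pair of record, one torus) `symbOp_sLap_comp_gOp` (`Δ∘Δ_a⁻¹ = 1 + (V − a•Q*Q)∘Δ_a⁻¹`, (1.73) + `Δ_aΔ_a⁻¹ = 1`), `idef_covLap_gOp_eq` (the identity for `(Δ′_a⁻¹, Δ_a⁻¹)`), ★★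
**`hasMaj_idef_covLap_of_letters`**: majorants `A₀e^{−ρd}` of `𝔇₀ = 𝔇(X′, X̄)`, `A₁e^{−ρd}` of `V′`, `A₂e^{−ρd}` of `V′P − PV̄`, `A₃e^{−ρd}` of `𝔇(a•Q′*Q′, a•Q̄*Q̄)`, `A₄e^{−ρd}` of `X̄`
(`ρ > 0`) give `HasMaj (ofBlocks geo blkFine) (ofBlocks geo blockOf′) (𝔇_P((Δ′ − V₁′)X′, (Δ̄ − V̄₁)X̄)) (((A₁A₀ + (A₂ + A₃)A₄)·K(ρ∕2) + |a|·A₀·e^{2ρ})·e^{−(ρ∕2)d})`, `K(σ) =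
latticeConst (d+1) σ`.  The hypothesis-free edition on the torus family (∃ δ r₀ B) is the sequel Λ-B; the four-entry packaging Λ-C.

HONEST FRAMING ∕ LIMITS.  Count-neutral algebra + block-majorant bookkeeping; `U ≡ 1` Landau-gauge pair `(Δ′_a⁻¹, Δ_a⁻¹)` of [B5] (1.69)–(1.73) on finite tori dressed by the ABELIANISED
scalar-multiplier species of (3.52)'s `V′(A)`, block-averaged coarse partner (C3) in the sequel; «covariant Laplacian» := `Δ − V₁` of the model — Bałaban's `Δ_U` of (3.50) differs by the
non-abelian (matrix ∕ shift) dressing (n15-c's lane, located); NE2⁺ as printed NOT PRINTED ∕ NOT proved; no statement of record touched; N15 NOT discharged; K3⁸ OPEN; counts UNMOVED (typed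
28∕28 · discharged 6∕28 of record); one finite torus per index — NOT ℝ⁴ ∕ infinite volume ∕ OS ∕ mass gap ∕ Clay.
-/

noncomputable section

open scoped BigOperators
open Finset

namespace Summit.QuantumFields.YangMills.BalabanUVNodes.N15.TwoGrid

open Literature.MathematicalPhysics.QuantumFieldTheory.Balaban1983to89
open Literature.MathematicalPhysics.QuantumFieldTheory.Balaban1983to89.B11SectG (BlockNorm HasMaj hasMaj_comp_exp)
open Literature.MathematicalPhysics.QuantumFieldTheory.Balaban1983to89.T4EtaRateDefect (idef idef_apply idef_comp idef_add idef_sub)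
open Literature.MathematicalPhysics.QuantumFieldTheory.Balaban1983to89.T4EtaRateCoeffDefect (pull pull_apply)
open Literature.MathematicalPhysics.QuantumFieldTheory.Balaban1983to89.B5Prop11Plancherel (Tor fine)
open Literature.MathematicalPhysics.QuantumFieldTheory.King1986.Torus (blockOf tdistT tdistT_nonneg)
open Literature.MathematicalPhysics.QuantumFieldTheory.Balaban1983to89.B6UnitTorusCarrier (unitTorusGeo unitTorusGeo_dist_nonneg triangle254_unitTorusGeo rowSum_unitTorusGeo)
open Summit.QuantumFields.YangMills.BalabanUVNodes.N15.VectorPiece (blkFine kingPrV)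
open Summit.QuantumFields.YangMills.BalabanUVNodes.N15.BackgroundLayer (bgPair stack unstack projO projO_none_bgPair)

variable {d : ℕ}

/-! ## §29 The covariant-Laplacian identity of a first-order dressed value (generic carriers) -/

section Identity

variable {X X' J : Type} [Fintype X] [Fintype X'] [Fintype J] [DecidableEq X] [DecidableEq X'] [DecidableEq J]

/-- **`Lap∘X − V₁X̂ = 1 + W∘X`** (generic carriers): for a piece `G` whose Laplacian letter reads `Lap∘G = 1 + W∘G` and the (3.65) jet `X̂ = bgPair G D c a` (fixed point available),
the dressed value `X = pr₀X̂ = G + G∘V₁X̂` (`V₁ = unstack c a`) satisfies `Lap∘X − V₁∘X̂ = 1 + W∘X` — the abelianised covariant Laplacian of the dressed value has NO first-order term on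
the right. [cite: Balaban1985BackgroundPropagators, (3.42) p.397 (fourth entry: the covariant Laplacian), (3.52) p.400, (3.65) p.402; Balaban1984PropagatorsI, (1.73) p.30] -/
theorem covLap_dressed_eq {G Lap W : (X → ℝ) →ₗ[ℝ] (X → ℝ)} {D : J → (X → ℝ) →ₗ[ℝ] (X → ℝ)} {c : X → ℝ} {a : J → X → ℝ}
    (hunit : IsUnit (1 - LinearMap.toMatrix' (stack G D ∘ₗ unstack c a))) (hLap : Lap ∘ₗ G = LinearMap.id + W ∘ₗ G) :
    Lap ∘ₗ (projO none ∘ₗ bgPair G D c a) - unstack c a ∘ₗ bgPair G D c a = LinearMap.id + W ∘ₗ (projO none ∘ₗ bgPair G D c a) := by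
  have hX := projO_none_bgPair (G := G) (D := D) (c := c) (a := a) hunit
  have h1 : Lap ∘ₗ (G ∘ₗ (unstack c a ∘ₗ bgPair G D c a)) = unstack c a ∘ₗ bgPair G D c a + W ∘ₗ (G ∘ₗ (unstack c a ∘ₗ bgPair G D c a)) := by
    rw [← LinearMap.comp_assoc, hLap, LinearMap.add_comp, LinearMap.id_comp, LinearMap.comp_assoc]
  rw [hX, LinearMap.comp_add, LinearMap.comp_add, hLap, h1]
  abel

/-- **THE η-DEFECT OF THE COVARIANT-LAPLACIAN ENTRY** (generic carriers): with both fixed points and both Laplacian letters `Lap∘G = 1 + W∘G`, `Lap′∘G′ = 1 + W′∘G′`,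
`𝔇_π(Lap′∘X′ − V₁′X̂′, Lap∘X − V₁X̂) = W′∘𝔇_π(X′, X) + 𝔇_π(W′, W)∘X` — `covLap_dressed_eq` differenced (`𝔇(1, 1) = 0`, Leibniz rule `idef_comp`).
[cite: Balaban1985BackgroundPropagators, (3.42) p.397 (fourth entry), (3.65) p.402; King1986, p.664 (the pairing)] -/
theorem idef_covLap_dressed_eq (π : X' → X) {G Lap W : (X → ℝ) →ₗ[ℝ] (X → ℝ)} {D : J → (X → ℝ) →ₗ[ℝ] (X → ℝ)} {c : X → ℝ} {a : J → X → ℝ}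
    {G' Lap' W' : (X' → ℝ) →ₗ[ℝ] (X' → ℝ)} {D' : J → (X' → ℝ) →ₗ[ℝ] (X' → ℝ)} {c' : X' → ℝ} {a' : J → X' → ℝ}
    (hunit : IsUnit (1 - LinearMap.toMatrix' (stack G D ∘ₗ unstack c a))) (hunit' : IsUnit (1 - LinearMap.toMatrix' (stack G' D' ∘ₗ unstack c' a')))
    (hLap : Lap ∘ₗ G = LinearMap.id + W ∘ₗ G) (hLap' : Lap' ∘ₗ G' = LinearMap.id + W' ∘ₗ G') :
    idef (pull π) (pull π) (Lap' ∘ₗ (projO none ∘ₗ bgPair G' D' c' a') - unstack c' a' ∘ₗ bgPair G' D' c' a')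
        (Lap ∘ₗ (projO none ∘ₗ bgPair G D c a) - unstack c a ∘ₗ bgPair G D c a)
      = W' ∘ₗ idef (pull π) (pull π) (projO none ∘ₗ bgPair G' D' c' a') (projO none ∘ₗ bgPair G D c a)
        + idef (pull π) (pull π) W' W ∘ₗ (projO none ∘ₗ bgPair G D c a) := by
  rw [covLap_dressed_eq hunit hLap, covLap_dressed_eq hunit' hLap', idef_add (pull π) (pull π), idef_comp (pull π) (pull π) (pull π)]
  have h0 : idef (pull π) (pull π) (LinearMap.id : (X' → ℝ) →ₗ[ℝ] (X' → ℝ)) (LinearMap.id : (X → ℝ) →ₗ[ℝ] (X → ℝ)) = 0 := by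
    rw [idef, LinearMap.id_comp, LinearMap.comp_id, sub_self]
  rw [h0, zero_add]

end Identity

/-! ## §30 The pair of record on one torus: the Laplacian letter of `Δ_a⁻¹`, the identity, the majorant from five letters -/

section Torus

variable {L : ℕ} [NeZero L] (M : Fin (d + 1) → ℕ) [∀ μ, NeZero (M μ)] (k m : ℕ) (a : ℝ)

/-- **THE LAPLACIAN LETTER OF `Δ_a⁻¹`**: `Δ∘Δ_a⁻¹ = 1 + (V − a•Q*Q)∘Δ_a⁻¹` — (1.73) `Δ_a = Δ − V + a•Q*Q` (`deltaOp_eq`) and `Δ_aΔ_a⁻¹ = 1` (`deltaOp_comp_gOp`).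
[cite: Balaban1984PropagatorsI, (1.69)–(1.73) pp.29–30] -/
theorem symbOp_sLap_comp_gOp (n : ℕ) [NeZero n] (hn : 1 ≤ n) (ha : 0 < a) :
    symbOp M n (sLap M n ((n : ℕ) : ℝ)) ∘ₗ gOp M n a = LinearMap.id + (landauRe M n - a • (qvAdjRe M n ∘ₗ qvRe M n)) ∘ₗ gOp M n a := by
  have h : symbOp M n (sLap M n ((n : ℕ) : ℝ)) = deltaOp M n a + (landauRe M n - a • (qvAdjRe M n ∘ₗ qvRe M n)) := by
    rw [deltaOp_eq]; abel
  rw [h, LinearMap.add_comp, deltaOp_comp_gOp M n a hn ha]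

/-- **THE η-DEFECT IDENTITY FOR THE PAIR OF RECORD**: with `X̂ = bgPair Δ_a⁻¹ (∇Δ_a⁻¹) c a` on the coarse grid, `X̂′` on the fine grid (both fixed points available), `P = pull kingPrV`,
`W = V − a•Q*Q`: `𝔇_P((Δ′ − V₁′)X′, (Δ − V₁)X̄) = W′∘𝔇_P(X′, X̄) + (𝔇_P(V′, V) − 𝔇_P(a•Q′*Q′, a•Q*Q))∘X̄`. [cite: Balaban1984PropagatorsI, (1.69)–(1.73) pp.29–30;
Balaban1985BackgroundPropagators, (3.42) p.397 (fourth entry), (3.65) p.402; King1986, p.664 (the pairing)] -/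
theorem idef_covLap_gOp_eq (ha : 0 < a) {c : Tor (fine (L ^ k) M) × Fin (d + 1) → ℝ} {ac : Fin (d + 1) → Tor (fine (L ^ k) M) × Fin (d + 1) → ℝ}
    {c' : Tor (fine (L ^ m * L ^ k) M) × Fin (d + 1) → ℝ} {a' : Fin (d + 1) → Tor (fine (L ^ m * L ^ k) M) × Fin (d + 1) → ℝ}
    (hunit : IsUnit (1 - LinearMap.toMatrix' (stack (gOp M (L ^ k) a) (fun μ => symbOp M (L ^ k) (sD M (L ^ k) μ ((L ^ k : ℕ) : ℝ)) ∘ₗ gOp M (L ^ k) a) ∘ₗ unstack c ac)))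
    (hunit' : IsUnit (1 - LinearMap.toMatrix' (stack (gOp M (L ^ m * L ^ k) a)
      (fun μ => symbOp M (L ^ m * L ^ k) (sD M (L ^ m * L ^ k) μ ((L ^ m * L ^ k : ℕ) : ℝ)) ∘ₗ gOp M (L ^ m * L ^ k) a) ∘ₗ unstack c' a'))) :
    idef (pull (kingPrV L k m M)) (pull (kingPrV L k m M))
        (symbOp M (L ^ m * L ^ k) (sLap M (L ^ m * L ^ k) ((L ^ m * L ^ k : ℕ) : ℝ)) ∘ₗ
            (projO none ∘ₗ bgPair (gOp M (L ^ m * L ^ k) a) (fun μ => symbOp M (L ^ m * L ^ k) (sD M (L ^ m * L ^ k) μ ((L ^ m * L ^ k : ℕ) : ℝ)) ∘ₗ gOp M (L ^ m * L ^ k) a) c' a')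
          - unstack c' a' ∘ₗ bgPair (gOp M (L ^ m * L ^ k) a) (fun μ => symbOp M (L ^ m * L ^ k) (sD M (L ^ m * L ^ k) μ ((L ^ m * L ^ k : ℕ) : ℝ)) ∘ₗ gOp M (L ^ m * L ^ k) a) c' a')
        (symbOp M (L ^ k) (sLap M (L ^ k) ((L ^ k : ℕ) : ℝ)) ∘ₗ
            (projO none ∘ₗ bgPair (gOp M (L ^ k) a) (fun μ => symbOp M (L ^ k) (sD M (L ^ k) μ ((L ^ k : ℕ) : ℝ)) ∘ₗ gOp M (L ^ k) a) c ac)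
          - unstack c ac ∘ₗ bgPair (gOp M (L ^ k) a) (fun μ => symbOp M (L ^ k) (sD M (L ^ k) μ ((L ^ k : ℕ) : ℝ)) ∘ₗ gOp M (L ^ k) a) c ac)
      = (landauRe M (L ^ m * L ^ k) - a • (qvAdjRe M (L ^ m * L ^ k) ∘ₗ qvRe M (L ^ m * L ^ k))) ∘ₗ
          idef (pull (kingPrV L k m M)) (pull (kingPrV L k m M))
            (projO none ∘ₗ bgPair (gOp M (L ^ m * L ^ k) a) (fun μ => symbOp M (L ^ m * L ^ k) (sD M (L ^ m * L ^ k) μ ((L ^ m * L ^ k : ℕ) : ℝ)) ∘ₗ gOp M (L ^ m * L ^ k) a) c' a')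
            (projO none ∘ₗ bgPair (gOp M (L ^ k) a) (fun μ => symbOp M (L ^ k) (sD M (L ^ k) μ ((L ^ k : ℕ) : ℝ)) ∘ₗ gOp M (L ^ k) a) c ac)
        + (idef (pull (kingPrV L k m M)) (pull (kingPrV L k m M)) (landauRe M (L ^ m * L ^ k)) (landauRe M (L ^ k))
            - idef (pull (kingPrV L k m M)) (pull (kingPrV L k m M)) (a • (qvAdjRe M (L ^ m * L ^ k) ∘ₗ qvRe M (L ^ m * L ^ k))) (a • (qvAdjRe M (L ^ k) ∘ₗ qvRe M (L ^ k)))) ∘ₗ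
          (projO none ∘ₗ bgPair (gOp M (L ^ k) a) (fun μ => symbOp M (L ^ k) (sD M (L ^ k) μ ((L ^ k : ℕ) : ℝ)) ∘ₗ gOp M (L ^ k) a) c ac) := by
  haveI : NeZero (L ^ k) := ⟨pow_ne_zero k (NeZero.ne L)⟩
  have hL0 : 0 < L := Nat.pos_of_ne_zero (NeZero.ne L)
  have hn : 1 ≤ L ^ k := Nat.one_le_pow _ _ hL0
  have hn' : 1 ≤ L ^ m * L ^ k := Nat.one_le_iff_ne_zero.mpr (NeZero.ne _)
  rw [idef_covLap_dressed_eq (kingPrV L k m M) hunit hunit' (symbOp_sLap_comp_gOp M a (L ^ k) hn ha) (symbOp_sLap_comp_gOp M a (L ^ m * L ^ k) hn' ha),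
    idef_sub (pull (kingPrV L k m M)) (pull (kingPrV L k m M))]

/-- ★★ **THE DRESSED COVARIANT-LAPLACIAN ENTRY OF THE PAIR OF RECORD FROM FIVE LETTERS (one torus, abstract constants)**: with `𝔇₀ = 𝔇_P(X′, X̄)` (entry 0 of the dressed jet) majorised by
`A₀e^{−ρd}`, `V′` by `A₁e^{−ρd}`, the Landau two-grid defect `V′P − PV` by `A₂e^{−ρd}`, the averaging two-grid letter `𝔇_P(a•Q′*Q′, a•Q*Q)` by `A₃e^{−ρd}` and the coarse dressed value
`X̄` by `A₄e^{−ρd}` (`ρ > 0`): `𝔇_P((Δ′ − V₁′)X′, (Δ − V₁)X̄) ≤ (((A₁A₀ + (A₂ + A₃)A₄)·K(ρ∕2) + |a|·A₀·e^{ρ}e^{ρ})·e^{−(ρ∕2)d}`, `K(σ) = latticeConst (d+1) σ` — `idef_covLap_gOp_eq` +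
`hasMaj_comp_exp` (twice) + part 57's `Q′`, `Q′*` rows. [cite: Balaban1984PropagatorsI, (1.69)–(1.73) pp.29–30, (1.18) p.20, (1.126) p.38; Balaban1985BackgroundPropagators, (3.42) p.397
(fourth entry), (3.62)–(3.65) pp.402–403; Balaban1984PropagatorsII, Lemma 2.1 (2.52)–(2.56) pp.232–233] -/
theorem hasMaj_idef_covLap_of_letters (ha : 0 < a) {c : Tor (fine (L ^ k) M) × Fin (d + 1) → ℝ} {ac : Fin (d + 1) → Tor (fine (L ^ k) M) × Fin (d + 1) → ℝ}
    {c' : Tor (fine (L ^ m * L ^ k) M) × Fin (d + 1) → ℝ} {a' : Fin (d + 1) → Tor (fine (L ^ m * L ^ k) M) × Fin (d + 1) → ℝ}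
    (hunit : IsUnit (1 - LinearMap.toMatrix' (stack (gOp M (L ^ k) a) (fun μ => symbOp M (L ^ k) (sD M (L ^ k) μ ((L ^ k : ℕ) : ℝ)) ∘ₗ gOp M (L ^ k) a) ∘ₗ unstack c ac)))
    (hunit' : IsUnit (1 - LinearMap.toMatrix' (stack (gOp M (L ^ m * L ^ k) a)
      (fun μ => symbOp M (L ^ m * L ^ k) (sD M (L ^ m * L ^ k) μ ((L ^ m * L ^ k : ℕ) : ℝ)) ∘ₗ gOp M (L ^ m * L ^ k) a) ∘ₗ unstack c' a')))
    {ρ A₀ A₁ A₂ A₃ A₄ : ℝ} (hρ : 0 < ρ) (hA₀ : 0 ≤ A₀) (hA₁ : 0 ≤ A₁) (hA₂ : 0 ≤ A₂) (hA₃ : 0 ≤ A₃) (hA₄ : 0 ≤ A₄)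
    (h₀ : HasMaj (BlockNorm.ofBlocks (unitTorusGeo L k M) (blkFine L k M)) (BlockNorm.ofBlocks (unitTorusGeo L k M) (fun i : Tor (fine (L ^ m * L ^ k) M) × Fin (d + 1) => blockOf (L ^ m * L ^ k) M i.1))
      (idef (pull (kingPrV L k m M)) (pull (kingPrV L k m M))
        (projO none ∘ₗ bgPair (gOp M (L ^ m * L ^ k) a) (fun μ => symbOp M (L ^ m * L ^ k) (sD M (L ^ m * L ^ k) μ ((L ^ m * L ^ k : ℕ) : ℝ)) ∘ₗ gOp M (L ^ m * L ^ k) a) c' a')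
        (projO none ∘ₗ bgPair (gOp M (L ^ k) a) (fun μ => symbOp M (L ^ k) (sD M (L ^ k) μ ((L ^ k : ℕ) : ℝ)) ∘ₗ gOp M (L ^ k) a) c ac))
      (fun y y' => A₀ * Real.exp (-(ρ * tdistT M y y'))))
    (h₁ : HasMaj (BlockNorm.ofBlocks (unitTorusGeo L k M) (fun i : Tor (fine (L ^ m * L ^ k) M) × Fin (d + 1) => blockOf (L ^ m * L ^ k) M i.1))
      (BlockNorm.ofBlocks (unitTorusGeo L k M) (fun i : Tor (fine (L ^ m * L ^ k) M) × Fin (d + 1) => blockOf (L ^ m * L ^ k) M i.1))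
      (landauRe M (L ^ m * L ^ k)) (fun y y' => A₁ * Real.exp (-(ρ * tdistT M y y'))))
    (h₂ : HasMaj (BlockNorm.ofBlocks (unitTorusGeo L k M) (blkFine L k M)) (BlockNorm.ofBlocks (unitTorusGeo L k M) (fun i : Tor (fine (L ^ m * L ^ k) M) × Fin (d + 1) => blockOf (L ^ m * L ^ k) M i.1))
      (landauRe M (L ^ m * L ^ k) ∘ₗ pull (kingPrV L k m M) - pull (kingPrV L k m M) ∘ₗ landauRe M (L ^ k)) (fun y y' => A₂ * Real.exp (-(ρ * tdistT M y y'))))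
    (h₃ : HasMaj (BlockNorm.ofBlocks (unitTorusGeo L k M) (blkFine L k M)) (BlockNorm.ofBlocks (unitTorusGeo L k M) (fun i : Tor (fine (L ^ m * L ^ k) M) × Fin (d + 1) => blockOf (L ^ m * L ^ k) M i.1))
      (idef (pull (kingPrV L k m M)) (pull (kingPrV L k m M))
        (a • (qvAdjRe M (L ^ m * L ^ k) ∘ₗ qvRe M (L ^ m * L ^ k))) (a • (qvAdjRe M (L ^ k) ∘ₗ qvRe M (L ^ k))))
      (fun y y' => A₃ * Real.exp (-(ρ * tdistT M y y'))))
    (h₄ : HasMaj (BlockNorm.ofBlocks (unitTorusGeo L k M) (blkFine L k M)) (BlockNorm.ofBlocks (unitTorusGeo L k M) (blkFine L k M))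
      (projO none ∘ₗ bgPair (gOp M (L ^ k) a) (fun μ => symbOp M (L ^ k) (sD M (L ^ k) μ ((L ^ k : ℕ) : ℝ)) ∘ₗ gOp M (L ^ k) a) c ac)
      (fun y y' => A₄ * Real.exp (-(ρ * tdistT M y y')))) :
    HasMaj (BlockNorm.ofBlocks (unitTorusGeo L k M) (blkFine L k M)) (BlockNorm.ofBlocks (unitTorusGeo L k M) (fun i : Tor (fine (L ^ m * L ^ k) M) × Fin (d + 1) => blockOf (L ^ m * L ^ k) M i.1))
      (idef (pull (kingPrV L k m M)) (pull (kingPrV L k m M))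
        (symbOp M (L ^ m * L ^ k) (sLap M (L ^ m * L ^ k) ((L ^ m * L ^ k : ℕ) : ℝ)) ∘ₗ
            (projO none ∘ₗ bgPair (gOp M (L ^ m * L ^ k) a) (fun μ => symbOp M (L ^ m * L ^ k) (sD M (L ^ m * L ^ k) μ ((L ^ m * L ^ k : ℕ) : ℝ)) ∘ₗ gOp M (L ^ m * L ^ k) a) c' a')
          - unstack c' a' ∘ₗ bgPair (gOp M (L ^ m * L ^ k) a) (fun μ => symbOp M (L ^ m * L ^ k) (sD M (L ^ m * L ^ k) μ ((L ^ m * L ^ k : ℕ) : ℝ)) ∘ₗ gOp M (L ^ m * L ^ k) a) c' a')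
        (symbOp M (L ^ k) (sLap M (L ^ k) ((L ^ k : ℕ) : ℝ)) ∘ₗ
            (projO none ∘ₗ bgPair (gOp M (L ^ k) a) (fun μ => symbOp M (L ^ k) (sD M (L ^ k) μ ((L ^ k : ℕ) : ℝ)) ∘ₗ gOp M (L ^ k) a) c ac)
          - unstack c ac ∘ₗ bgPair (gOp M (L ^ k) a) (fun μ => symbOp M (L ^ k) (sD M (L ^ k) μ ((L ^ k : ℕ) : ℝ)) ∘ₗ gOp M (L ^ k) a) c ac))
      (fun y y' => ((A₁ * A₀ + (A₂ + A₃) * A₄) * B4Sect5Proof.latticeConst (d + 1) (ρ / 2) + |a| * A₀ * Real.exp ρ * Real.exp ρ)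
        * Real.exp (-(ρ / 2 * tdistT M y y'))) := by
  classical
  have hσ0 : 0 < ρ / 2 := by linarith
  have he0 : 0 ≤ Real.exp ρ := Real.exp_nonneg _
  set bC := BlockNorm.ofBlocks (unitTorusGeo L k M) (blkFine L k M) with hbC
  set bF := BlockNorm.ofBlocks (unitTorusGeo L k M) (fun i : Tor (fine (L ^ m * L ^ k) M) × Fin (d + 1) => blockOf (L ^ m * L ^ k) M i.1) with hbF
  -- (1) `V′∘𝔇₀`
  have e1 := hasMaj_comp_exp (b₁ := bC) (b₂ := bF) (b₃ := bF) (triangle254_unitTorusGeo L k M) (unitTorusGeo_dist_nonneg L k M) (rowSum_unitTorusGeo L k M hσ0)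
    hA₁ hA₀ hσ0.le (by linarith) (by linarith) h₁ h₀
  -- (2) `a•Q′*∘(Q′∘𝔇₀)`
  have e2₀ := hasMaj_qvAdjRe_comp M k (L ^ m * L ^ k) (b₁ := bC) (mul_nonneg hA₀ he0) hρ.le (hasMaj_qvRe_comp M k (L ^ m * L ^ k) (b₁ := bC) hA₀ hρ.le h₀)
  have e2 := hasMaj_smul_ofBlocks (g := unitTorusGeo L k M) (b₁ := bC) (fun i : Tor (fine (L ^ m * L ^ k) M) × Fin (d + 1) => blockOf (L ^ m * L ^ k) M i.1)
    (fun y y' => by positivity) a e2₀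
  -- (3) `(𝔇(V′,V) − 𝔇(aQ′*Q′, aQ*Q))∘X̄`
  have e3₀ : HasMaj bC bF (idef (pull (kingPrV L k m M)) (pull (kingPrV L k m M)) (landauRe M (L ^ m * L ^ k)) (landauRe M (L ^ k))
      - idef (pull (kingPrV L k m M)) (pull (kingPrV L k m M)) (a • (qvAdjRe M (L ^ m * L ^ k) ∘ₗ qvRe M (L ^ m * L ^ k))) (a • (qvAdjRe M (L ^ k) ∘ₗ qvRe M (L ^ k))))
      (fun y y' => (A₂ + A₃) * Real.exp (-(ρ * tdistT M y y'))) :=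
    (h₂.sub h₃).mono fun y y' => le_of_eq (by ring)
  have e3 := hasMaj_comp_exp (b₁ := bC) (b₂ := bC) (b₃ := bF) (triangle254_unitTorusGeo L k M) (unitTorusGeo_dist_nonneg L k M) (rowSum_unitTorusGeo L k M hσ0)
    (add_nonneg hA₂ hA₃) hA₄ hσ0.le (by linarith) (by linarith) e3₀ h₄
  -- the identity
  have hκF : bF.κ = 1 := rfl
  have hκC : bC.κ = 1 := rfl
  refine (((e1.sub e2).add e3).congr fun μ => ?_).mono fun y y' => ?_
  · rw [idef_covLap_gOp_eq M k m a ha hunit hunit']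
    simp only [LinearMap.add_apply, LinearMap.sub_apply, LinearMap.smul_apply, LinearMap.comp_apply]
  · have hE : Real.exp (-(ρ * tdistT M y y')) ≤ Real.exp (-(ρ / 2 * tdistT M y y')) := Real.exp_le_exp.mpr (by nlinarith [tdistT_nonneg M y y'])
    have hY : 0 ≤ |a| * A₀ * Real.exp ρ * Real.exp ρ := by positivity
    rw [hκF, hκC]
    calc 1 * A₁ * A₀ * B4Sect5Proof.latticeConst (d + 1) (ρ / 2) * Real.exp (-(ρ / 2 * tdistT M y y'))
          + |a| * (A₀ * Real.exp ρ * Real.exp ρ * Real.exp (-(ρ * tdistT M y y')))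
          + 1 * (A₂ + A₃) * A₄ * B4Sect5Proof.latticeConst (d + 1) (ρ / 2) * Real.exp (-(ρ / 2 * tdistT M y y'))
        = (A₁ * A₀ + (A₂ + A₃) * A₄) * B4Sect5Proof.latticeConst (d + 1) (ρ / 2) * Real.exp (-(ρ / 2 * tdistT M y y'))
          + |a| * A₀ * Real.exp ρ * Real.exp ρ * Real.exp (-(ρ * tdistT M y y')) := by ring
      _ ≤ (A₁ * A₀ + (A₂ + A₃) * A₄) * B4Sect5Proof.latticeConst (d + 1) (ρ / 2) * Real.exp (-(ρ / 2 * tdistT M y y'))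
          + |a| * A₀ * Real.exp ρ * Real.exp ρ * Real.exp (-(ρ / 2 * tdistT M y y')) := add_le_add le_rfl (mul_le_mul_of_nonneg_left hE hY)
      _ = _ := by ring

end Torus

end Summit.QuantumFields.YangMills.BalabanUVNodes.N15.TwoGrid

end
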